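import Summits.QuantumFields.BalabanUV.Beta.SymCorrectorKernel
import Summits.QuantumFields.BalabanUV.Beta.CompositeCorrectorBordered
import Summits.QuantumFields.BalabanUV.Beta.RelInvCompositeSocket
import Summits.QuantumFields.BalabanUV.Beta.FP.RelInvPeriodisedComb

/-!
# `BalabanUV.Beta.SymCorrectorTransport` — binder row D1, PART 23 re-ruling (F-g22-1 ∕ Q-g22-1, leaf-03 g28 N-g28-1 «CHART-TRANSPORT»), brick TT2b — **THE END:
# THE CHART-(III′) INTERIOR COMB KERNEL IS THE bm-CHART ONE-SHOT KERNEL AT THE CENTRE ROOT CONJUGATED BY THE SYMMETRISED CORRECTOR** —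
# `GcombSh n 0 = Ψ̂_S ∘ coDressKBmAt ρ_c n (KInv n) ∘ Ψ̂_Sᵀ`, `Ψ̂_S = psiKS (ctrOff (d+1) n) n` (`SymCorrectorKernel`), `ρ_c = ctr (d+1) n = toSite (ctrOff (d+1) n)`.

HOW ([folklore] composition BY NAME).  §1 reads the four blocks of the re-linearised bordered operator `Φ̂_Sᵀ ∘ bhK n ∘ Φ̂_S` (decl-by-decl twin of leaf-09 g39's
`CompositeCorrectorBordered` over an2's action lemmas `comp_bhK_inl ∕ comp_bhK_inr ∕ tsum_bhK_inl_inl ∕ tsum_bhK_inr_inl`, with TT1's `curv_corrPhiS` (flatness) and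
`contourSum_corrPhiS_eq_symLinAvgAt` (re-linearisation `contourSum n (Φ_S A) = (d+1)!⁻¹ • symLinAvgAt ρ A n`)) and identifies the result, at the centre root, with an1's
(0.4)-SYMMETRISED ROOTED BORDERED HESSIAN: **`Φ̂_Sᵀ ∘ bhK n ∘ Φ̂_S = bhK n + Dsh n`** (`DshAn1.bhK_add_Dsh_inr_inl ∕ _inl_inr`).  §2 feeds TT2a's five corrector letters
(`spr_psiKS ∕ spr_phiKS`, `comp_psiKS_phiKS ∕ comp_phiKS_psiKS`, `comp_comp_axEc_psiKS ∕ _phiKS`) and §1 to the row's socket `RelInvCompositeSocket.relInv_composite_of_corrector'`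
(an2 g24, K-U3d L4a): `RelInv (Ψ̂_S∘G₀^{bm}(ρ_c)∘Ψ̂_Sᵀ) (bhK n + Dsh n) (axEc ρ_c n)`; road «FP»'s `RelInvPeriodisedComb.relInv_GcombSh_bhKStepSh 0` (leaf-05 g29) + `bhKStepSh_zero` give
`RelInv (GcombSh n 0) (bhK n + Dsh n) (axEc ρ_c n)`; §3 a relative inverse is UNIQUE given `(𝕄, E)` (`relInv_unique_kernel`, the `MKer` form of an2 g23's matrix
`RelInvCombBorderedKKT.relInv_unique`) ⟹ the END.

WHAT IT MEANS (zero weight beyond the identity; the row reads it).  The (III′) literal's kernel and the road «BF-x»'s kernel at root `ctrOff` differ by an explicit UNIPOTENT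
(`Ψ̂_S∘Φ̂_S = 1`, `Ψ̂_S − 1 = |box|⁻¹·dz∘ext∘ζ_S` with `ζ_S∘dz∘ext = 0`), block-local, FACE-supported corrector reading one scalar per block (the normalised symmetrised block potential);
the multiplier legs are untouched (`Ψ̂_S`'s multiplier block is the identity).  NOTHING of (K), of the four row-D1 binders (hW ∕ hR ∕ D1Tel ∕ D1Rep — 0∕4), of D1 or of BetaPertH is
discharged; no estimate; levels `j ≥ 1` are not touched.

HONEST FRAMING (cell contract, verbatim): «discharging `BetaPertH` makes Bałaban's UV stability UNCONDITIONAL — a real constructive-QFT result; it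
is NOT the continuum limit and NOT the Clay problem.»  HONEST DEPENDENCY (verbatim): «continuum YM on T⁴ ⇐ BetaPertH ∧ nine spine estimates (0/9
proved); BetaPertH ⇐ (D1) ∧ (D4) ∧ CAP+tail; G-an2-4 gates asym, D1 and NE2/3/4.»
ABSOLUTE RULE (cell, verbatim): «No internally-minted statement may enter as a cited fact. Every hypothesis is either kernel-proved in this package or a
verbatim quotation of a PUBLISHED theorem with page reference. The manuscript(s) under audit are NOT citable for their own disputed steps — they are the
thing under adjudication; programme-internal (2001/route/tribunal) claims are never citable.»  NOTHING is cited; no `def`, no `Prop` fact; 0 sorry.  NOT continuum, NOT Clay.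

CONTENT ([folklore]; `d+1` the lattice dimension, `0 < n`, root offset `r ∈ box (d+1) n`, `ρ = toSite r`):
§1 termwise actions `comp_trK_phiKS_inl_left ∕ _inr_left`, `comp_phiKS_inr_right`, `comp_trK_phiKS_bhK_inl_inl`, `comp_comp_trK_phiKS_bhK_phiKS_inl`, `comp_bhK_phiKS_inl_inl`,
   `comp_bhK_phiKS_inr_inl`, `comp_trK_phiKS_bhK_inl_inr`; the four entries `trK_phiKS_bhK_phiKS_inl_inl ∕ _inr_inl ∕ _inl_inr ∕ _inr_inr`;
   **`trK_phiKS_bhK_phiKS_eq_bhK_add_Dsh`** (centre root).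
§2 **`relInv_conj_psiKS_bhK_add_Dsh`** (the socket, instantiated).  §3 `relInv_unique_kernel`; **`GcombSh_zero_eq_conj_psiKS`**, `GcombSh_zero_eq_conj_psiKS_KInvStep`.
§4 (T-col) **`colH_conj_psiKS`** (`colH (Ψ̂_S∘K∘Ψ̂_Sᵀ) = Ψ_S (colH K)`, any `K`), `conj_psiKS_inr_inr`; **`colH_GcombSh_zero_eq_corrPsiS`**, **`GcombSh_zero_inr_inr_eq`**.
Provenance: D1 formalisation swarm, unit `b2b-balaban-beta-d1-formalise-leaf-03` (gen 28), 2026-08-22; no existing file touched.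
-/

namespace Summit.QuantumFields.BalabanUV.Beta.SymCorrectorTransport

open Finset
open scoped BigOperators Nat
open Literature.Probability.LatticeModels (Torus.proj)
open Literature.MathematicalPhysics.QuantumFieldTheory
open Literature.MathematicalPhysics.QuantumFieldTheory.Balaban1983to89
open Literature.MathematicalPhysics.QuantumFieldTheory.Balaban1983to89.Beta
open ExpKernelCalculus (MKer comp)
open AffineAveraging (Form0 Form1 box toSite unitVec dz curv curvAdj contourSum)
open AffineReproduction (contourSumAdj)
open AveragingContoursRooted (ctr ctrOff ctrOff_mem_box)
open LatticeForm (quo)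
open KKTFluctuationKernel (delta1 delta1_apply)
open OneStepResolventKernel (Fib KInv)
open OneStepKernelFamily (KInvStep)
open Summit.QuantumFields.BalabanUV.Beta.TameKernelCalculus
open Summit.QuantumFields.BalabanUV.Beta.ChartConjugationRelative (RelInv spr_comp)
open Summit.QuantumFields.BalabanUV.Beta.RelInvCongruenceKernel (assoc)
open Summit.QuantumFields.BalabanUV.Beta.AxialDressingRooted (axEc spr_axEc coDressKBmAt spr_coDressKBmAt tsum_point tsum_point')
open Summit.QuantumFields.BalabanUV.Beta.BorderedHessian (bhK bhK_inl_inl bhK_inl_inr bhK_inr_inl bhK_inr_inr bhK_inl_inl_eq fcol mcol fcol_apply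
  mcol_apply comp_bhK_inl comp_bhK_inr tsum_bhK_inl_inl tsum_bhK_inr_inl curvAdj_curv_delta1_symm contourSum_delta1_eq_contourSumAdj
  contourSumAdj_zero spr_bhK spr_KInv KInvStep_zero_eq)
open Summit.QuantumFields.BalabanUV.Beta.DshAn1 (Dsh Dsh_inl_inl Dsh_inr_inr spr_Dsh bhK_add_Dsh_inr_inl bhK_add_Dsh_inl_inr)
open Summit.QuantumFields.BalabanUV.Beta.SymShiftedSpread (bhKStepSh bhKStepSh_zero)
open Summit.QuantumFields.BalabanUV.Beta.SymmetrisedAxialPotential (symLinAvgAt)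
open Summit.QuantumFields.BalabanUV.Beta.RelInvNullShift (spr_add)
open Summit.QuantumFields.BalabanUV.Beta.CombChartStepJets (GcombSh)
open Summit.QuantumFields.BalabanUV.Beta.CombChartContactFactor (spr_GcombSh)
open Summit.QuantumFields.BalabanUV.Beta.FP.RelInvPeriodisedComb (relInv_GcombSh_bhKStepSh)
open Summit.QuantumFields.BalabanUV.Beta.RelInvCompositeSocket (relInv_composite_of_corrector')
open Summit.QuantumFields.BalabanUV.Beta.SymCorrectorForms (corrPhiS contourSum_corrPhiS_eq_symLinAvgAt curv_corrPhiS)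
open Summit.QuantumFields.BalabanUV.Beta.CompositeCorrectorKernel (indR indR_apply)
open Summit.QuantumFields.BalabanUV.Beta.CompositeCorrectorBordered (indR_eq_delta1)
open Summit.QuantumFields.BalabanUV.Beta.SymCorrectorKernel (psiKS phiKS phiKS_inl_inl phiKS_inl_inr phiKS_inr_inl phiKS_inr_inr spr_psiKS spr_phiKS
  comp_psiKS_phiKS comp_phiKS_psiKS comp_comp_axEc_psiKS comp_comp_axEc_phiKS)

noncomputable section

variable {d : ℕ}

/-! ## §1 The blocks of the re-linearised bordered operator `Φ̂_Sᵀ ∘ bhK n ∘ Φ̂_S` -/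

section Bordered

variable (r : Fin (d + 1) → ℕ) (n : ℕ)

/-- [folklore] LEFT ACTION OF `Φ̂_Sᵀ`, FIELD ROWS: `(Φ̂_Sᵀ ∘ K)(x,z)_{inl α, b} = Σ'_y Σ_l (Φ_S δ_{(α,x)})_l(y) · K(y,z)_{inl l, b}`. -/
theorem comp_trK_phiKS_inl_left (K : MKer (d + 1) (Fib d)) (x z : Fin (d + 1) → ℤ) (α : Fin (d + 1)) (b : Fib d) :
    comp (trK (phiKS r n)) K x z (Sum.inl α) b = ∑' y, ∑ l : Fin (d + 1), corrPhiS (toSite r) n (indR α x) l y * K y z (Sum.inl l) b := by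
  unfold ExpKernelCalculus.comp
  refine tsum_congr fun y => ?_
  rw [Fintype.sum_sum_type]
  simp only [trK_apply, phiKS_inl_inl, phiKS_inr_inl, zero_mul, Finset.sum_const_zero, add_zero]

/-- [folklore] LEFT ACTION OF `Φ̂_Sᵀ`, MULTIPLIER ROWS: the row is picked. -/
theorem comp_trK_phiKS_inr_left (K : MKer (d + 1) (Fib d)) (x z : Fin (d + 1) → ℤ) (μ : Fin (d + 1)) (b : Fib d) :
    comp (trK (phiKS r n)) K x z (Sum.inr μ) b = K x z (Sum.inr μ) b := by
  unfold ExpKernelCalculus.comp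
  have e : ∀ y, ∑ f : Fib d, trK (phiKS r n) x y (Sum.inr μ) f * K y z f b = if x = y then K y z (Sum.inr μ) b else 0 := by
    intro y
    rw [Fintype.sum_sum_type]
    simp only [trK_apply, phiKS_inl_inr, zero_mul, Finset.sum_const_zero, zero_add, phiKS_inr_inr]
    rw [Finset.sum_eq_single μ (fun μ' _ hμ' => by rw [if_neg (fun h => hμ' h.2), zero_mul]) (fun h => absurd (Finset.mem_univ μ) h)]
    by_cases hy : x = y
    · rw [if_pos ⟨hy.symm, rfl⟩, one_mul, if_pos hy]
    · rw [if_neg (fun h => hy h.1.symm), zero_mul, if_neg hy]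
  simp_rw [e]
  exact tsum_point x _

/-- [folklore] MULTIPLIER COLUMNS OF `K ∘ Φ̂_S`: the column is picked. -/
theorem comp_phiKS_inr_right (K : MKer (d + 1) (Fib d)) (x z : Fin (d + 1) → ℤ) (a : Fib d) (μ : Fin (d + 1)) :
    comp K (phiKS r n) x z a (Sum.inr μ) = K x z a (Sum.inr μ) := by
  unfold ExpKernelCalculus.comp
  have e : ∀ y, ∑ f : Fib d, K x y a f * phiKS r n y z f (Sum.inr μ) = if y = z then K x y a (Sum.inr μ) else 0 := by
    intro y
    rw [Fintype.sum_sum_type]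
    simp only [phiKS_inl_inr, mul_zero, Finset.sum_const_zero, zero_add, phiKS_inr_inr]
    rw [Finset.sum_eq_single μ (fun μ' _ hμ' => by rw [if_neg (fun h => hμ' h.2), mul_zero]) (fun h => absurd (Finset.mem_univ μ) h)]
    by_cases hy : y = z
    · rw [if_pos ⟨hy, rfl⟩, mul_one, if_pos hy]
    · rw [if_neg (fun h => hy h.1), mul_zero, if_neg hy]
  simp_rw [e]
  rw [tsum_point' z (fun y => K x y a (Sum.inr μ))]

/-- [folklore] Field–field entry of `Φ̂_Sᵀ ∘ bhK`: UNCHANGED (matrix symmetry of `d*d` + flatness `curv_corrPhiS`). -/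
theorem comp_trK_phiKS_bhK_inl_inl (x z : Fin (d + 1) → ℤ) (α β : Fin (d + 1)) :
    comp (trK (phiKS r n)) (bhK n) x z (Sum.inl α) (Sum.inl β) = bhK n x z (Sum.inl α) (Sum.inl β) := by
  rw [comp_trK_phiKS_inl_left]
  have e : ∀ y, ∑ l : Fin (d + 1), corrPhiS (toSite r) n (indR α x) l y * bhK n y z (Sum.inl l) (Sum.inl β) =
      ∑ l : Fin (d + 1), bhK n z y (Sum.inl β) (Sum.inl l) * phiKS r n y x (Sum.inl l) (Sum.inl α) := by
    intro y
    refine Finset.sum_congr rfl fun l _ => ?_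
    rw [bhK_inl_inl_eq, curvAdj_curv_delta1_symm, ← bhK_inl_inl_eq n z y β l, phiKS_inl_inl, mul_comm]
  simp_rw [e]
  have hf : fcol (phiKS r n) x (Sum.inl α) = corrPhiS (toSite r) n (indR α x) := by
    funext l y; rw [fcol_apply, phiKS_inl_inl]
  rw [tsum_bhK_inl_inl, hf, curv_corrPhiS, indR_eq_delta1, curvAdj_curv_delta1_symm, ← bhK_inl_inl_eq]

/-- [folklore] The field columns of `(Φ̂_Sᵀ ∘ bhK) ∘ Φ̂_S` are those of `bhK ∘ Φ̂_S` (termwise). -/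
theorem comp_comp_trK_phiKS_bhK_phiKS_inl (x z : Fin (d + 1) → ℤ) (a : Fib d) (β : Fin (d + 1)) :
    comp (comp (trK (phiKS r n)) (bhK n)) (phiKS r n) x z a (Sum.inl β) = comp (bhK n) (phiKS r n) x z a (Sum.inl β) := by
  unfold ExpKernelCalculus.comp
  refine tsum_congr fun y => ?_
  rw [Fintype.sum_sum_type, Fintype.sum_sum_type]
  simp only [phiKS_inr_inl, mul_zero, Finset.sum_const_zero, add_zero]
  refine Finset.sum_congr rfl fun l _ => ?_
  rcases a with α | μ
  · show comp (trK (phiKS r n)) (bhK n) x y (Sum.inl α) (Sum.inl l) * _ = _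
    rw [comp_trK_phiKS_bhK_inl_inl r n]
  · show comp (trK (phiKS r n)) (bhK n) x y (Sum.inr μ) (Sum.inl l) * _ = _
    rw [comp_trK_phiKS_inr_left]

variable {n} (hn : 0 < n)
include hn

/-- [folklore] Field–field entry of `bhK ∘ Φ̂_S`: UNCHANGED (`curv_corrPhiS`). -/
theorem comp_bhK_phiKS_inl_inl (x z : Fin (d + 1) → ℤ) (κ β : Fin (d + 1)) :
    comp (bhK n) (phiKS r n) x z (Sum.inl κ) (Sum.inl β) = curvAdj (curv (delta1 β z)) κ x := by
  haveI : NeZero n := ⟨hn.ne'⟩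
  have hf : fcol (phiKS r n) z (Sum.inl β) = corrPhiS (toSite r) n (indR β z) := by
    funext l y; rw [fcol_apply, phiKS_inl_inl]
  have hm : mcol n (phiKS r n) z (Sum.inl β) = 0 := by
    funext l y'; rw [mcol_apply, phiKS_inr_inl]; rfl
  rw [comp_bhK_inl, hf, hm, curv_corrPhiS, indR_eq_delta1, contourSumAdj_zero, Pi.zero_apply, Pi.zero_apply, sub_zero]

/-- [folklore] Multiplier–field entry of `bhK ∘ Φ̂_S`: THE RE-LINEARISED BORDER `[proj x = 0]·(d+1)!⁻¹·symLinAvgAt ρ δ_{(β,z)} n κ (x∕n)`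
(`contourSum_corrPhiS_eq_symLinAvgAt`). -/
theorem comp_bhK_phiKS_inr_inl (x z : Fin (d + 1) → ℤ) (κ β : Fin (d + 1)) :
    comp (bhK n) (phiKS r n) x z (Sum.inr κ) (Sum.inl β) =
      if Torus.proj n x = 0 then (((d + 1) ! : ℕ) : ℝ)⁻¹ * symLinAvgAt (toSite r) (delta1 β z) n κ (quo n x) else 0 := by
  haveI : NeZero n := ⟨hn.ne'⟩
  have hf : fcol (phiKS r n) z (Sum.inl β) = corrPhiS (toSite r) n (indR β z) := by
    funext l y; rw [fcol_apply, phiKS_inl_inl]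
  rw [comp_bhK_inr, hf, indR_eq_delta1]
  split_ifs with hx
  · rw [contourSum_corrPhiS_eq_symLinAvgAt (toSite r) hn]
  · rfl

/-- [folklore] Field–multiplier entry of `Φ̂_Sᵀ ∘ bhK`: minus the transposed re-linearised border. -/
theorem comp_trK_phiKS_bhK_inl_inr (x z : Fin (d + 1) → ℤ) (α μ : Fin (d + 1)) :
    comp (trK (phiKS r n)) (bhK n) x z (Sum.inl α) (Sum.inr μ) =
      if Torus.proj n z = 0 then -((((d + 1) ! : ℕ) : ℝ)⁻¹ * symLinAvgAt (toSite r) (delta1 α x) n μ (quo n z)) else 0 := by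
  haveI : NeZero n := ⟨hn.ne'⟩
  rw [comp_trK_phiKS_inl_left]
  by_cases hz : Torus.proj n z = 0
  · have e : ∀ y, ∑ l : Fin (d + 1), corrPhiS (toSite r) n (indR α x) l y * bhK n y z (Sum.inl l) (Sum.inr μ) =
        -(∑ l : Fin (d + 1), bhK n z y (Sum.inr μ) (Sum.inl l) * phiKS r n y x (Sum.inl l) (Sum.inl α)) := by
      intro y
      rw [← Finset.sum_neg_distrib]
      refine Finset.sum_congr rfl fun l _ => ?_
      rw [bhK_inl_inr, if_pos hz, bhK_inr_inl, if_pos hz, contourSum_delta1_eq_contourSumAdj, phiKS_inl_inl]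
      ring
    simp_rw [e]
    have hf : fcol (phiKS r n) x (Sum.inl α) = corrPhiS (toSite r) n (indR α x) := by
      funext l y; rw [fcol_apply, phiKS_inl_inl]
    rw [tsum_neg, tsum_bhK_inr_inl n hz, hf, indR_eq_delta1, contourSum_corrPhiS_eq_symLinAvgAt (toSite r) hn, if_pos hz]
  · have e : ∀ y, ∑ l : Fin (d + 1), corrPhiS (toSite r) n (indR α x) l y * bhK n y z (Sum.inl l) (Sum.inr μ) = 0 := by
      intro y
      refine Finset.sum_eq_zero fun l _ => ?_
      rw [bhK_inl_inr, if_neg hz, mul_zero]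
    simp_rw [e]
    rw [tsum_zero, if_neg hz]

/-- [folklore] **FIELD–FIELD ENTRY OF `Φ̂_Sᵀ ∘ bhK n ∘ Φ̂_S`: UNCHANGED** (`= bhK n`, the windowed matrix of `d*d`). -/
theorem trK_phiKS_bhK_phiKS_inl_inl (x z : Fin (d + 1) → ℤ) (κ β : Fin (d + 1)) :
    comp (comp (trK (phiKS r n)) (bhK n)) (phiKS r n) x z (Sum.inl κ) (Sum.inl β) = bhK n x z (Sum.inl κ) (Sum.inl β) := by
  rw [comp_comp_trK_phiKS_bhK_phiKS_inl r n, comp_bhK_phiKS_inl_inl r hn, bhK_inl_inl_eq]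

/-- [folklore] **MULTIPLIER–FIELD ENTRY: THE SYMMETRISED BORDER** `[proj x = 0]·(d+1)!⁻¹·symLinAvgAt ρ δ_{(β,z)} n κ (x∕n)`. -/
theorem trK_phiKS_bhK_phiKS_inr_inl (x z : Fin (d + 1) → ℤ) (κ β : Fin (d + 1)) :
    comp (comp (trK (phiKS r n)) (bhK n)) (phiKS r n) x z (Sum.inr κ) (Sum.inl β) =
      if Torus.proj n x = 0 then (((d + 1) ! : ℕ) : ℝ)⁻¹ * symLinAvgAt (toSite r) (delta1 β z) n κ (quo n x) else 0 := by
  rw [comp_comp_trK_phiKS_bhK_phiKS_inl r n, comp_bhK_phiKS_inr_inl r hn]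

/-- [folklore] **FIELD–MULTIPLIER ENTRY: MINUS THE TRANSPOSED SYMMETRISED BORDER.** -/
theorem trK_phiKS_bhK_phiKS_inl_inr (x z : Fin (d + 1) → ℤ) (α μ : Fin (d + 1)) :
    comp (comp (trK (phiKS r n)) (bhK n)) (phiKS r n) x z (Sum.inl α) (Sum.inr μ) =
      if Torus.proj n z = 0 then -((((d + 1) ! : ℕ) : ℝ)⁻¹ * symLinAvgAt (toSite r) (delta1 α x) n μ (quo n z)) else 0 := by
  rw [comp_phiKS_inr_right]
  exact comp_trK_phiKS_bhK_inl_inr r hn x z α μ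

omit hn in
/-- [folklore] **MULTIPLIER–MULTIPLIER ENTRY: ZERO.** -/
theorem trK_phiKS_bhK_phiKS_inr_inr (x z : Fin (d + 1) → ℤ) (μ₀ μ : Fin (d + 1)) :
    comp (comp (trK (phiKS r n)) (bhK n)) (phiKS r n) x z (Sum.inr μ₀) (Sum.inr μ) = 0 := by
  rw [comp_phiKS_inr_right, comp_trK_phiKS_inr_left, bhK_inr_inr]

end Bordered

/-- [folklore] **THE RE-LINEARISED BORDERED OPERATOR AT THE CENTRE ROOT IS an1's (0.4)-SYMMETRISED ROOTED BORDERED HESSIAN**: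
`Φ̂_Sᵀ ∘ bhK n ∘ Φ̂_S = bhK n + Dsh n` for `Φ̂_S = phiKS (ctrOff (d+1) n) n` (`DshAn1.bhK_add_Dsh_inr_inl ∕ _inl_inr`; `ctr (d+1) n = toSite (ctrOff (d+1) n)`). -/
theorem trK_phiKS_bhK_phiKS_eq_bhK_add_Dsh (n : ℕ) [NeZero n] :
    comp (comp (trK (phiKS (ctrOff (d + 1) n) n)) (bhK n)) (phiKS (ctrOff (d + 1) n) n) = bhK n + Dsh (d := d) n := by
  have hn : 0 < n := Nat.pos_of_ne_zero (NeZero.ne n)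
  funext x z a b
  rcases a with κ | μ <;> rcases b with β | μ'
  · rw [trK_phiKS_bhK_phiKS_inl_inl _ hn]
    show _ = bhK n x z (Sum.inl κ) (Sum.inl β) + Dsh n x z (Sum.inl κ) (Sum.inl β)
    rw [Dsh_inl_inl, add_zero]
  · rw [trK_phiKS_bhK_phiKS_inl_inr _ hn, bhK_add_Dsh_inl_inr]
    rfl
  · rw [trK_phiKS_bhK_phiKS_inr_inl _ hn, bhK_add_Dsh_inr_inl]
    rfl
  · rw [trK_phiKS_bhK_phiKS_inr_inr]
    show (0 : ℝ) = bhK n x z (Sum.inr μ) (Sum.inr μ') + Dsh n x z (Sum.inr μ) (Sum.inr μ')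
    rw [bhK_inr_inr, Dsh_inr_inr, add_zero]

/-! ## §2 The socket instantiated: the conjugated bm kernel is a relative inverse of the symmetrised bordered Hessian off the centred comb -/

/-- [folklore] **`RelInv (Ψ̂_S ∘ coDressKBmAt ρ_c n (KInv n) ∘ Ψ̂_Sᵀ) (bhK n + Dsh n) (axEc ρ_c n)`** — the row's K-U3d socket `RelInvCompositeSocket.relInv_composite_of_corrector'`
at the in-block root offset `ctrOff (d+1) n`, its six corrector hypotheses discharged BY NAME (TT2a §3–§5, §1 above). -/
theorem relInv_conj_psiKS_bhK_add_Dsh (n : ℕ) [NeZero n] :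
    RelInv (comp (comp (psiKS (ctrOff (d + 1) n) n) (coDressKBmAt (ctr (d + 1) n) n (KInv (N := n) (d := d)))) (trK (psiKS (ctrOff (d + 1) n) n)))
      (bhK n + Dsh n) (axEc (ctr (d + 1) n) n) := by
  have hn : 0 < n := Nat.pos_of_ne_zero (NeZero.ne n)
  have hr : ctrOff (d + 1) n ∈ box (d + 1) n := ctrOff_mem_box hn
  exact relInv_composite_of_corrector' hr (spr_psiKS hn hr) (spr_phiKS hn hr) (comp_psiKS_phiKS hn hr) (comp_phiKS_psiKS hn hr)
    (comp_comp_axEc_psiKS _ n hr) (comp_comp_axEc_phiKS _ n hr) (trK_phiKS_bhK_phiKS_eq_bhK_add_Dsh n).symm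

/-! ## §3 Uniqueness of the relative inverse; THE END -/

section Unique

variable {D : ℕ} {F : Type*} [Fintype F] {A A' M E : MKer D F}

/-- [folklore] **A RELATIVE INVERSE IS UNIQUE GIVEN `(𝕄, E)`** (kernel currency; spread kernels): `RelInv A 𝕄 E ∧ RelInv A′ 𝕄 E ⟹ A = A′` — both equal `A∘𝕄∘A′`
(`A′ = E∘A′ = (A∘𝕄∘E)∘A′`, `A = A∘E = A∘(E∘𝕄∘A′)`; the matrix form is an2 g23's `RelInvCombBorderedKKT.relInv_unique`). -/
theorem relInv_unique_kernel (hA : Spr A) (hA' : Spr A') (hM : Spr M) (hE : Spr E) (h : RelInv A M E) (h' : RelInv A' M E) : A = A' := by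
  have e1 : A' = comp (comp A M) A' := by
    calc A' = comp E A' := h'.EA.symm
      _ = comp (comp (comp A M) E) A' := by rw [h.AME]
      _ = comp (comp A M) (comp E A') := by rw [← assoc (spr_comp hA hM) hE hA']
      _ = comp (comp A M) A' := by rw [h'.EA]
  have e2 : A = comp (comp A M) A' := by
    calc A = comp A E := h.AE.symm
      _ = comp A (comp (comp E M) A') := by rw [h'.EMA]
      _ = comp (comp A (comp E M)) A' := by rw [assoc hA (spr_comp hE hM) hA']
      _ = comp (comp (comp A E) M) A' := by rw [assoc hA hE hM]
      _ = comp (comp A M) A' := by rw [h.AE]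
  rw [e2, ← e1]

end Unique

/-- [folklore] **THE END — CHART TRANSPORT: `GcombSh n 0 = Ψ̂_S ∘ coDressKBmAt ρ_c n (KInv n) ∘ Ψ̂_Sᵀ`.**  The chart-(III′) interior comb kernel at level `0` IS the
bm-chart one-shot kernel at the centre root conjugated by the kernelised symmetrised corrector `Ψ̂_S = psiKS (ctrOff (d+1) n) n` (uniqueness §3 between §2 and road «FP»'s
`relInv_GcombSh_bhKStepSh 0`, `bhKStepSh d n (Dsh n) 0 = bhK n + Dsh n`). -/
theorem GcombSh_zero_eq_conj_psiKS (n : ℕ) [NeZero n] :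
    GcombSh (d := d) n 0
      = comp (comp (psiKS (ctrOff (d + 1) n) n) (coDressKBmAt (ctr (d + 1) n) n (KInv (N := n) (d := d)))) (trK (psiKS (ctrOff (d + 1) n) n)) := by
  have hn : 0 < n := Nat.pos_of_ne_zero (NeZero.ne n)
  have hr : ctrOff (d + 1) n ∈ box (d + 1) n := ctrOff_mem_box hn
  have hG : RelInv (GcombSh (d := d) n 0) (bhK n + Dsh n) (axEc (ctr (d + 1) n) n) := by
    rw [← bhKStepSh_zero]; exact relInv_GcombSh_bhKStepSh (d := d) (Lc := n) 0
  have hΨ : Spr (psiKS (d := d) (ctrOff (d + 1) n) n) := spr_psiKS hn hr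
  exact relInv_unique_kernel (spr_GcombSh (d := d) (Lc := n) 0)
    (spr_comp (spr_comp hΨ (spr_coDressKBmAt hn hr (spr_KInv (N := n) (d := d)))) hΨ.trK)
    (spr_add (spr_bhK hn) (spr_Dsh hn)) (spr_axEc _ _) hG (relInv_conj_psiKS_bhK_add_Dsh n)

/-- [folklore] The same with the bm kernel written as the level-`0` step resolvent `coDressKBmAt ρ_c n (KInvStep n 0)` (the road «BF-x» leg `G₀^{bm}` at root `ctrOff`;
`KInvStep_zero_eq`). -/
theorem GcombSh_zero_eq_conj_psiKS_KInvStep (n : ℕ) [NeZero n] :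
    GcombSh (d := d) n 0
      = comp (comp (psiKS (ctrOff (d + 1) n) n) (coDressKBmAt (ctr (d + 1) n) n (KInvStep (d := d) n 0))) (trK (psiKS (ctrOff (d + 1) n) n)) := by
  rw [KInvStep_zero_eq]; exact GcombSh_zero_eq_conj_psiKS n

/-! ## §4 First corollaries for the `Δ_n` program: the packing column transports by `Ψ_S`, the multiplier block is untouched -/

section Columns

open OneStepKernelFamily (colH)
open Summit.QuantumFields.BalabanUV.Beta.SymCorrectorForms (corrPsiS)
open Summit.QuantumFields.BalabanUV.Beta.SymCorrectorKernel (comp_psiKS_inl comp_psiKS_inr comp_trK_psiKS_inr)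

variable {n : ℕ} (hn : 0 < n) {r : Fin (d + 1) → ℕ} (hr : r ∈ box (d + 1) n)
include hn hr

/-- [folklore] **(T-col) THE `ℋ`-COLUMN OF A `Ψ̂_S`-CONJUGATE IS `Ψ_S` OF THE `ℋ`-COLUMN** — for ANY kernel `K`:
`colH (Ψ̂_S ∘ K ∘ Ψ̂_Sᵀ) n μ y = Ψ_S (colH K n μ y)` as 1-forms in `(κ′, u)` (the multiplier block of `Ψ̂_Sᵀ` is the identity, its mixed blocks vanish; apply bridge).
This is W-1 of the road's `J1-DEFECT-WORDS` §6: the packing column's defect is the fine PURE GAUGE `|box|⁻¹ • dz (ext n (ζ_S (colH K n μ y)))` with a BLOCK-CONSTANT gauge function. -/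
theorem colH_conj_psiKS (K : MKer (d + 1) (Fib d)) (μ : Fin (d + 1)) (y : Fin (d + 1) → ℤ) :
    colH (comp (comp (psiKS r n) K) (trK (psiKS r n))) n μ y = corrPsiS (toSite r) n (colH K n μ y) := by
  funext κ' u
  show comp (comp (psiKS r n) K) (trK (psiKS r n)) u ((n : ℤ) • y) (Sum.inl κ') (Sum.inr μ) = _
  rw [comp_trK_psiKS_inr, comp_psiKS_inl hn hr]
  rfl

omit hn hr in
/-- [folklore] **THE MULTIPLIER–MULTIPLIER BLOCK OF A `Ψ̂_S`-CONJUGATE IS UNTOUCHED**: `(Ψ̂_S ∘ K ∘ Ψ̂_Sᵀ) x z (inr m) (inr m′) = K x z (inr m) (inr m′)`. -/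
theorem conj_psiKS_inr_inr (K : MKer (d + 1) (Fib d)) (x z : Fin (d + 1) → ℤ) (m m' : Fin (d + 1)) :
    comp (comp (psiKS r n) K) (trK (psiKS r n)) x z (Sum.inr m) (Sum.inr m') = K x z (Sum.inr m) (Sum.inr m') := by
  rw [comp_trK_psiKS_inr, comp_psiKS_inr]

end Columns

section CombColumns

open OneStepKernelFamily (colH)
open Summit.QuantumFields.BalabanUV.Beta.SymCorrectorForms (corrPsiS)

/-- [folklore] **THE (III′) PACKING COLUMN IS `Ψ_S` OF THE ROAD's**: `colH (GcombSh n 0) n μ y = Ψ_S (colH (G₀^{bm} ρ_c) n μ y)`, `Ψ_S = corrPsiS ρ_c n`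
(END + (T-col)) — the literal's `ℋ`-column differs from the road «BF-x» column at root `ctrOff` by the coarse gradient of a block-constant function. -/
theorem colH_GcombSh_zero_eq_corrPsiS (n : ℕ) [NeZero n] (μ : Fin (d + 1)) (y : Fin (d + 1) → ℤ) :
    colH (GcombSh (d := d) n 0) n μ y
      = corrPsiS (ctr (d + 1) n) n (colH (coDressKBmAt (ctr (d + 1) n) n (KInvStep (d := d) n 0)) n μ y) := by
  have hn : 0 < n := Nat.pos_of_ne_zero (NeZero.ne n)
  rw [GcombSh_zero_eq_conj_psiKS_KInvStep]
  exact colH_conj_psiKS hn (ctrOff_mem_box hn) _ μ y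

/-- [folklore] **THE (III′) KERNEL AND THE ROAD's KERNEL HAVE THE SAME MULTIPLIER–MULTIPLIER BLOCK** (hence the same next-level coarse operator). -/
theorem GcombSh_zero_inr_inr_eq (n : ℕ) [NeZero n] (x z : Fin (d + 1) → ℤ) (m m' : Fin (d + 1)) :
    GcombSh (d := d) n 0 x z (Sum.inr m) (Sum.inr m')
      = coDressKBmAt (ctr (d + 1) n) n (KInvStep (d := d) n 0) x z (Sum.inr m) (Sum.inr m') := by
  rw [GcombSh_zero_eq_conj_psiKS_KInvStep]
  exact conj_psiKS_inr_inr _ x z m m'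

end CombColumns

end

end Summit.QuantumFields.BalabanUV.Beta.SymCorrectorTransport
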